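import Mathlib
import HarnessLib
import Literature.Probability.MarkovChains.MetropolisHastings
import Literature.Probability.MarkovChains.PeskunOrdering

/-!
# Pozza–Zanella: a `K`-proposal MCMC kernel is Peskun-dominated by `K` times a single-proposal
# Metropolis–Hastings kernel, so its spectral gap is at most `K` times larger (finite state spaces)

[cite: PozzaZanella2025, §2 Algorithm 1 and eq. (1); §3.1 Theorem 1, Corollary 1; §6.1–6.2 (proofs)]

Pozza and Zanella consider Markov chains of the following structure ("general multiproposal MCMC
algorithm", their Algorithm 1): given the current state `x`, draw an ordered tuple of `K ≥ 1`
candidates `ys = (y_1, …, y_K) ∼ Q(x, ·)` from an ARBITRARY Markov kernel `Q` from `X` to `X^K`,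
then move to `y_i` with probability `h_i(x, ys)` and stay at `x` with probability
`1 − Σ_i h_i(x, ys)`, for an ARBITRARY selection function `h : X × X^K → S_K`
(`S_K = {s ∈ [0,1]^K : Σ s_i ≤ 1}`).  Equivalently (their eq. (1) / Proposition 3)
`P^{(K)}(x, A) = Σ_i ∫ 1_A(y_i) h_i(x, ys) Q(x, dys)` for `x ∉ A`.  Multiple-try Metropolis
(their Example 1) and Tjelmeland's rule (Example 2) are instances; no assumption is made on `h` or
on the dependence structure of `Q`.

**Theorem 1.** If `P^{(K)}` is `π`-reversible then, off the diagonal,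
`P^{(K)}(x, A∖{x}) ≤ K · P̃(x, A∖{x})`, where `P̃` is the (single-proposal) Metropolis–Hastings
kernel with target `π` and proposal `Q̃ = K⁻¹ Σ_i Q_i`, `Q_i(x, ·)` the `i`-th marginal of
`Q(x, ·)`.  **Corollary 1.** `Gap(P^{(K)}) ≤ K · Gap(P̃)`.

This file is the finite-state-space case (`X` a `Fintype`, densities = point masses, `π > 0`
pointwise standing in for "`π`-a.e."), in the vocabulary of `MetropolisHastings.lean`
(`mhKernel`, `mhRate`, `DetailedBalance`, `IsRowStochastic`) and `PeskunOrdering.lean`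
(`dirichletForm`, `spectralGapR` = the right spectral gap `Gap_R`, which is the paper's
`Gap(P) = inf_f 𝓔_P(f) / Var_π(f)` written on mean-zero unit-norm test functions).

## Content

* `mpMove`, `mpStay`, `mpKernel` — the kernel of Algorithm 1 for a joint proposal law
  `Q : X → (Fin K → X) → ℝ` and a selection function `h : X → (Fin K → X) → Fin K → ℝ`;
  `mpKernel_of_ne`, `mpKernel_isRowStochastic`, `mpKernel_self` (agreement with eq. (1):
  `P(x,{x}) = 1 − P(x, X∖{x})`).
* `mpMarginal Q i`, `mpMixture Q` — the marginals `Q_i` and the mixture `Q̃ = K⁻¹ Σ_i Q_i`;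
  `mpMixture_isRowStochastic`.
* `mpMove_le_sum_mpMarginal` — the first display of the proof, `P^{(K)}(x, ·) ≤ Σ_i Q_i(x, ·)`
  off the diagonal (uses only `h_i ≤ 1` and `Q ≥ 0`).
* **`mpKernel_offDiag_le`** — THEOREM 1: `π`-reversibility of `P^{(K)}` gives
  `P^{(K)}(x, y) ≤ K · P̃(x, y)` for `x ≠ y`, `P̃ = mhKernel (mpMixture Q) π`.
* `dirichletForm_smul_kernel`, `spectralGapR_smul_kernel` — `𝓔_{cP} = c 𝓔_P` and
  `Gap_R(cP) = c · Gap_R(P)` for `c ≥ 0` (bookkeeping for the factor `K`).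
* **`spectralGapR_mpKernel_le`** — COROLLARY 1: `Gap_R(P^{(K)}) ≤ K · Gap_R(P̃)` ("classical
  results about the implications of Peskun ordering", here `PeskunOrdering.spectralGapR_mono_of_
  offDiag_le` applied to `P^{(K)}` and `K · P̃`).

NOT CLAIMED here: the general-state-space statement (measurable `A`, `π`-a.e. `x`); Lemma 1,
Theorem 2, Corollary 2 and §4 of the paper (Euclidean targets, log-concave bounds); any statement
about parallel wall-clock cost.
-- TODO(general form): general measurable state spaces (the printed setting).
-/

namespace Literature.Probability.MarkovChains

open Finset

variable {X : Type*} [Fintype X] [DecidableEq X] {K : ℕ}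

/-! ## The objects of Algorithm 1 -/

/-- MOVE part of the multiproposal kernel: the probability that one update from `x` proposes a
tuple `ys ∼ Q(x,·)`, selects a coordinate `i` carrying the value `y`, and moves there,
`Σ_{ys} Q(x, ys) Σ_i 1{ys_i = y} h_i(x, ys)` — eq. (1) of the paper evaluated at `A = {y}`.
[cite: PozzaZanella2025, §2 eq. (1)] -/
noncomputable def mpMove (Q : X → (Fin K → X) → ℝ) (h : X → (Fin K → X) → Fin K → ℝ)
    (x y : X) : ℝ :=
  ∑ ys : Fin K → X, Q x ys * ∑ i, if ys i = y then h x ys i else 0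

/-- STAY part: the probability `Σ_{ys} Q(x, ys) (1 − Σ_i h_i(x, ys))` that no candidate is
selected. [cite: PozzaZanella2025, §2 Algorithm 1 ("with probabilities
`(1 − Σ_i h_i(x, ys), h_1(x, ys), …, h_K(x, ys))`")] -/
noncomputable def mpStay (Q : X → (Fin K → X) → ℝ) (h : X → (Fin K → X) → Fin K → ℝ)
    (x : X) : ℝ :=
  ∑ ys : Fin K → X, Q x ys * (1 - ∑ i, h x ys i)

/-- The transition matrix `P^{(K)}` of the general multiproposal MCMC algorithm with joint
proposal law `Q(x, ys)` on ordered `K`-tuples and selection function `h`: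
`P^{(K)}(x, y) = mpMove(x, y) + 1{y = x} · mpStay(x)`.
[cite: PozzaZanella2025, §2 Algorithm 1, eq. (1), Appendix Proposition 3 (equivalence of the
algorithmic and kernel descriptions)] -/
noncomputable def mpKernel (Q : X → (Fin K → X) → ℝ) (h : X → (Fin K → X) → Fin K → ℝ) :
    Matrix X X ℝ :=
  fun x y => mpMove Q h x y + if y = x then mpStay Q h x else 0

/-- The `i`-th marginal proposal kernel `Q_i(x, y) = Q(x, {ys : ys_i = y})`.
[cite: PozzaZanella2025, §2 Example 1 ("`Q_i(x,·)` … the marginal distribution of `Y_i` … under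
`Y_{1:K} ∼ Q(x,·)`")] -/
noncomputable def mpMarginal (Q : X → (Fin K → X) → ℝ) (i : Fin K) (x y : X) : ℝ :=
  ∑ ys : Fin K → X, if ys i = y then Q x ys else 0

/-- The mixture of the marginals, `Q̃ = K⁻¹ Σ_{i=1}^K Q_i` — the proposal of the dominating
single-proposal Metropolis–Hastings kernel `P̃`. [cite: PozzaZanella2025, §3.1 Theorem 1
("`Q̃ = K⁻¹ Σ_{i=1}^K Q_i`")] -/
noncomputable def mpMixture (Q : X → (Fin K → X) → ℝ) (x y : X) : ℝ :=
  (K : ℝ)⁻¹ * ∑ i, mpMarginal Q i x y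

section Basic

variable {Q : X → (Fin K → X) → ℝ} {h : X → (Fin K → X) → Fin K → ℝ}

/-- Off the diagonal the kernel is its move part. [cite: PozzaZanella2025, §2 eq. (1)] -/
theorem mpKernel_of_ne (Q : X → (Fin K → X) → ℝ) (h : X → (Fin K → X) → Fin K → ℝ) {x y : X}
    (hxy : x ≠ y) : mpKernel Q h x y = mpMove Q h x y := by
  unfold mpKernel
  rw [if_neg (Ne.symm hxy), add_zero]

/-- Total move probability out of `x` (all targets, `x` itself included):
`Σ_y mpMove(x, y) = Σ_{ys} Q(x, ys) Σ_i h_i(x, ys)`. [cite: PozzaZanella2025, §2 Algorithm 1] -/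
theorem sum_mpMove (Q : X → (Fin K → X) → ℝ) (h : X → (Fin K → X) → Fin K → ℝ) (x : X) :
    ∑ y, mpMove Q h x y = ∑ ys : Fin K → X, Q x ys * ∑ i, h x ys i := by
  unfold mpMove
  rw [sum_comm]
  refine sum_congr rfl fun ys _ => ?_
  rw [← mul_sum, sum_comm]
  congr 1
  exact sum_congr rfl fun i _ => by rw [sum_ite_eq univ (ys i), if_pos (mem_univ _)]

/-- The rows of `P^{(K)}` sum to one whenever `Q(x, ·)` is a probability vector on `K`-tuples.
[cite: PozzaZanella2025, §2 Algorithm 1, Appendix Proposition 3] -/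
theorem sum_mpKernel (hQ1 : ∀ x, ∑ ys : Fin K → X, Q x ys = 1) (x : X) :
    ∑ y, mpKernel Q h x y = 1 := by
  unfold mpKernel
  rw [sum_add_distrib, sum_ite_eq' univ x, if_pos (mem_univ _), sum_mpMove]
  unfold mpStay
  rw [← sum_add_distrib]
  calc ∑ ys : Fin K → X, (Q x ys * ∑ i, h x ys i + Q x ys * (1 - ∑ i, h x ys i))
      = ∑ ys : Fin K → X, Q x ys := sum_congr rfl fun ys _ => by ring
    _ = 1 := hQ1 x

/-- The move part is non-negative for `Q ≥ 0`, `h ≥ 0`. [cite: PozzaZanella2025, §2] -/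
theorem mpMove_nonneg (hQ : ∀ x ys, 0 ≤ Q x ys) (hh0 : ∀ x ys i, 0 ≤ h x ys i) (x y : X) :
    0 ≤ mpMove Q h x y :=
  sum_nonneg fun ys _ => mul_nonneg (hQ x ys) (sum_nonneg fun i _ => by
    split_ifs
    · exact hh0 x ys i
    · exact le_rfl)

omit [DecidableEq X] in
/-- The stay part is non-negative for `Q ≥ 0` and `Σ_i h_i ≤ 1` (`h` takes values in the simplex
`S_K`). [cite: PozzaZanella2025, §2 ("`S_K = {(s_1,…,s_K) ∈ [0,1]^K : Σ s_i ≤ 1}`")] -/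
theorem mpStay_nonneg (hQ : ∀ x ys, 0 ≤ Q x ys) (hh1 : ∀ x ys, ∑ i, h x ys i ≤ 1) (x : X) :
    0 ≤ mpStay Q h x :=
  sum_nonneg fun ys _ => mul_nonneg (hQ x ys) (by linarith [hh1 x ys])

/-- All entries of `P^{(K)}` are non-negative (`Q ≥ 0`, `h ∈ S_K`). [cite: PozzaZanella2025, §2] -/
theorem mpKernel_nonneg (hQ : ∀ x ys, 0 ≤ Q x ys) (hh0 : ∀ x ys i, 0 ≤ h x ys i)
    (hh1 : ∀ x ys, ∑ i, h x ys i ≤ 1) (x y : X) : 0 ≤ mpKernel Q h x y := by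
  unfold mpKernel
  split_ifs
  · exact add_nonneg (mpMove_nonneg hQ hh0 x y) (mpStay_nonneg hQ hh1 x)
  · rw [add_zero]; exact mpMove_nonneg hQ hh0 x y

/-- `P^{(K)}` is a stochastic matrix when `Q(x,·)` is a probability vector and `h ∈ S_K`.
[cite: PozzaZanella2025, §2 Algorithm 1, Appendix Proposition 3] -/
theorem mpKernel_isRowStochastic (hQ : ∀ x ys, 0 ≤ Q x ys) (hQ1 : ∀ x, ∑ ys : Fin K → X, Q x ys = 1)
    (hh0 : ∀ x ys i, 0 ≤ h x ys i) (hh1 : ∀ x ys, ∑ i, h x ys i ≤ 1) :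
    IsRowStochastic (mpKernel Q h) :=
  ⟨mpKernel_nonneg hQ hh0 hh1, sum_mpKernel hQ1⟩

/-- Agreement with the convention of eq. (1): `P^{(K)}(x, {x}) = 1 − P^{(K)}(x, X∖{x})`.
[cite: PozzaZanella2025, §2 (the line after eq. (1))] -/
theorem mpKernel_self (hQ1 : ∀ x, ∑ ys : Fin K → X, Q x ys = 1) (x : X) :
    mpKernel Q h x x = 1 - ∑ y ∈ univ.erase x, mpKernel Q h x y := by
  have h1 := sum_mpKernel (h := h) hQ1 x
  rw [← add_sum_erase univ _ (mem_univ x)] at h1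
  linarith

/-- The marginals are non-negative. [cite: PozzaZanella2025, §2 Example 1] -/
theorem mpMarginal_nonneg (hQ : ∀ x ys, 0 ≤ Q x ys) (i : Fin K) (x y : X) :
    0 ≤ mpMarginal Q i x y :=
  sum_nonneg fun ys _ => by
    split_ifs
    · exact hQ x ys
    · exact le_rfl

/-- Each marginal is a probability vector. [cite: PozzaZanella2025, §2 Example 1] -/
theorem sum_mpMarginal (hQ1 : ∀ x, ∑ ys : Fin K → X, Q x ys = 1) (i : Fin K) (x : X) :
    ∑ y, mpMarginal Q i x y = 1 := by
  unfold mpMarginal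
  rw [sum_comm, ← hQ1 x]
  exact sum_congr rfl fun ys _ => by rw [sum_ite_eq univ (ys i), if_pos (mem_univ _)]

/-- `Σ_i Q_i = K · Q̃`. [cite: PozzaZanella2025, §3.1 Theorem 1 (definition of `Q̃`)] -/
theorem sum_mpMarginal_eq_mul_mpMixture (Q : X → (Fin K → X) → ℝ) (x y : X) :
    ∑ i, mpMarginal Q i x y = K * mpMixture Q x y := by
  unfold mpMixture
  rcases Nat.eq_zero_or_pos K with hK | hK
  · subst hK
    simp
  · rw [mul_inv_cancel_left₀ (by exact_mod_cast hK.ne')]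

/-- The mixture `Q̃` is non-negative. [cite: PozzaZanella2025, §3.1] -/
theorem mpMixture_nonneg (hQ : ∀ x ys, 0 ≤ Q x ys) (x y : X) : 0 ≤ mpMixture Q x y :=
  mul_nonneg (inv_nonneg.2 (Nat.cast_nonneg K))
    (sum_nonneg fun i _ => mpMarginal_nonneg hQ i x y)

/-- For `K ≥ 1` the mixture `Q̃(x, ·)` is a probability vector. [cite: PozzaZanella2025, §3.1] -/
theorem mpMixture_isRowStochastic (hK : 0 < K) (hQ : ∀ x ys, 0 ≤ Q x ys)
    (hQ1 : ∀ x, ∑ ys : Fin K → X, Q x ys = 1) : IsRowStochastic (mpMixture Q) := by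
  refine ⟨mpMixture_nonneg hQ, fun x => ?_⟩
  unfold mpMixture
  rw [← mul_sum, sum_comm]
  simp_rw [sum_mpMarginal hQ1]
  rw [sum_const, card_univ, Fintype.card_fin, nsmul_eq_mul, mul_one,
    inv_mul_cancel₀ (by exact_mod_cast hK.ne')]

end Basic

/-! ## Theorem 1 -/

section TheoremOne

variable {Q : X → (Fin K → X) → ℝ} {h : X → (Fin K → X) → Fin K → ℝ} {π : X → ℝ}

/-- First display of the proof: since `h_i ≤ 1`,
`P^{(K)}(x, y) ≤ Σ_i Σ_{ys} 1{ys_i = y} Q(x, ys) = Σ_i Q_i(x, y)`.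
[cite: PozzaZanella2025, §6.1 (display (eq:ineq_1))] -/
theorem mpMove_le_sum_mpMarginal (hQ : ∀ x ys, 0 ≤ Q x ys) (hh : ∀ x ys i, h x ys i ≤ 1)
    (x y : X) : mpMove Q h x y ≤ ∑ i, mpMarginal Q i x y := by
  unfold mpMove mpMarginal
  rw [sum_comm]
  refine sum_le_sum fun ys _ => ?_
  rw [mul_sum]
  refine sum_le_sum fun i _ => ?_
  split_ifs
  · exact mul_le_of_le_one_right (hQ x ys) (hh x ys i)
  · rw [mul_zero]

/-- **THEOREM 1 (finite state space).** Let `P^{(K)} = mpKernel Q h` be `π`-reversible for a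
positive `π`, with `Q ≥ 0` and `h_i ≤ 1`.  Then for `x ≠ y`
`P^{(K)}(x, y) ≤ K · P̃(x, y)`, where `P̃` is the single-proposal Metropolis–Hastings kernel with
target `π` and proposal `Q̃ = K⁻¹ Σ_i Q_i`.  Proof as printed: `π(x)P(x,y) = min{π(x)P(x,y),
π(y)P(y,x)} ≤ min{π(x) K Q̃(x,y), π(y) K Q̃(y,x)} = K π(x) P̃(x,y)`.
[cite: PozzaZanella2025, §3.1 Theorem 1; §6.1 (proof)] -/
theorem mpKernel_offDiag_le (hπ : ∀ x, 0 < π x) (hQ : ∀ x ys, 0 ≤ Q x ys)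
    (hh : ∀ x ys i, h x ys i ≤ 1) (hrev : DetailedBalance π (mpKernel Q h)) {x y : X}
    (hxy : x ≠ y) : mpKernel Q h x y ≤ K * mhKernel (mpMixture Q) π x y := by
  have hK : (0 : ℝ) ≤ K := Nat.cast_nonneg K
  have hb : ∀ a b : X, a ≠ b → mpKernel Q h a b ≤ K * mpMixture Q a b := by
    intro a b hab
    rw [mpKernel_of_ne Q h hab]
    exact (mpMove_le_sum_mpMarginal hQ hh a b).trans_eq (sum_mpMarginal_eq_mul_mpMixture Q a b)
  have key : π x * mpKernel Q h x y ≤ π x * (K * mhKernel (mpMixture Q) π x y) := by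
    calc π x * mpKernel Q h x y
        = min (π x * mpKernel Q h x y) (π y * mpKernel Q h y x) := by rw [← hrev x y, min_self]
      _ ≤ min (π x * (K * mpMixture Q x y)) (π y * (K * mpMixture Q y x)) :=
          min_le_min (mul_le_mul_of_nonneg_left (hb x y hxy) (hπ x).le)
            (mul_le_mul_of_nonneg_left (hb y x hxy.symm) (hπ y).le)
      _ = K * min (π x * mpMixture Q x y) (π y * mpMixture Q y x) := by
          rw [mul_min_of_nonneg _ _ hK]; congr 1 <;> ring
      _ = K * (π x * mhRate (mpMixture Q) π x y) := by rw [mul_mhRate hπ]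
      _ = π x * (K * mhKernel (mpMixture Q) π x y) := by
          rw [mhKernel_of_ne (Ne.symm hxy)]; ring
  exact le_of_mul_le_mul_left key (hπ x)

end TheoremOne

/-! ## Corollary 1 -/

section CorollaryOne

open scoped Pointwise

omit [DecidableEq X] in
/-- `𝓔_{cP}(u) = c · 𝓔_P(u)`: the Dirichlet form is linear in the kernel (the bookkeeping behind
"speed up convergence relative to `P̃` by at most a factor of `K`"). [cite: PozzaZanella2025, §3.1
(discussion after Theorem 1, display defining `Gap(P)`)] -/
theorem dirichletForm_smul_kernel (π : X → ℝ) (P : Matrix X X ℝ) (c : ℝ) (u : X → ℝ) :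
    dirichletForm π (c • P) u = c * dirichletForm π P u := by
  unfold dirichletForm
  have e : ∀ x y, π x * (c • P) x y * (u x - u y) ^ 2 = c * (π x * P x y * (u x - u y) ^ 2) := by
    intro x y
    rw [Matrix.smul_apply, smul_eq_mul]
    ring
  simp only [e, ← Finset.mul_sum]
  ring

omit [DecidableEq X] in
/-- `Gap_R(cP) = c · Gap_R(P)` for `c ≥ 0`: the infimum defining the spectral gap scales with the
kernel. [cite: PozzaZanella2025, §3.1 (display defining `Gap(P)`; "(1) implies an analogous bound
on the corresponding spectral gaps")] -/
theorem spectralGapR_smul_kernel (π : X → ℝ) (P : Matrix X X ℝ) {c : ℝ} (hc : 0 ≤ c) :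
    spectralGapR π (c • P) = c * spectralGapR π P := by
  unfold spectralGapR
  have hset : ((fun f => dirichletForm π (c • P) f) ''
      {f : X → ℝ | ∑ x, π x * f x = 0 ∧ piInner π f f = 1}) =
      c • ((fun f => dirichletForm π P f) ''
        {f : X → ℝ | ∑ x, π x * f x = 0 ∧ piInner π f f = 1}) := by
    rw [← Set.image_smul, Set.image_image]
    exact Set.image_congr fun f _ => by rw [dirichletForm_smul_kernel, smul_eq_mul]
  rw [hset, Real.sInf_smul_of_nonneg hc, smul_eq_mul]

variable {Q : X → (Fin K → X) → ℝ} {h : X → (Fin K → X) → Fin K → ℝ} {π : X → ℝ}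

/-- **COROLLARY 1 (finite state space).** Under the assumptions of Theorem 1, with `h` taking
values in the simplex `S_K` (so that `P^{(K)}` is a non-negative matrix),
`Gap_R(P^{(K)}) ≤ K · Gap_R(P̃)`: a `K`-proposal scheme improves the spectral gap of the
single-proposal Metropolis–Hastings kernel with the averaged proposal by at most the factor `K`.
[cite: PozzaZanella2025, §3.1 Corollary 1; §6.2 (proof: "follows directly from Theorem 1 and
classical results about the implications of Peskun ordering")] -/
theorem spectralGapR_mpKernel_le (hπ : ∀ x, 0 < π x) (hQ : ∀ x ys, 0 ≤ Q x ys)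
    (hh0 : ∀ x ys i, 0 ≤ h x ys i) (hh1 : ∀ x ys, ∑ i, h x ys i ≤ 1)
    (hrev : DetailedBalance π (mpKernel Q h)) :
    spectralGapR π (mpKernel Q h) ≤
      K * spectralGapR π (mhKernel (mpMixture Q) π : Matrix X X ℝ) := by
  have hh : ∀ x ys i, h x ys i ≤ 1 := fun x ys i =>
    (single_le_sum (fun j _ => hh0 x ys j) (mem_univ i)).trans (hh1 x ys)
  rw [← spectralGapR_smul_kernel _ _ (Nat.cast_nonneg K)]
  refine spectralGapR_mono_of_offDiag_le (fun x => (hπ x).le) (mpKernel_nonneg hQ hh0 hh1)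
    fun x y hxy => ?_
  rw [Matrix.smul_apply, smul_eq_mul]
  exact mpKernel_offDiag_le hπ hQ hh hrev hxy

/-- The serial reading of Corollary 1 in Dirichlet-form terms, for every test function:
`𝓔_{P^{(K)}}(u) ≤ K · 𝓔_{P̃}(u)`. [cite: PozzaZanella2025, §3.1 (discussion after Theorem 1:
"`P^{(K)}` can speed up convergence relative to `P̃` by at most a factor of `K`")] -/
theorem dirichletForm_mpKernel_le (hπ : ∀ x, 0 < π x) (hQ : ∀ x ys, 0 ≤ Q x ys)
    (hh : ∀ x ys i, h x ys i ≤ 1) (hrev : DetailedBalance π (mpKernel Q h)) (u : X → ℝ) :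
    dirichletForm π (mpKernel Q h) u ≤
      K * dirichletForm π (mhKernel (mpMixture Q) π : Matrix X X ℝ) u := by
  rw [← dirichletForm_smul_kernel]
  refine dirichletForm_mono (fun x => (hπ x).le) (fun x y hxy => ?_) u
  rw [Matrix.smul_apply, smul_eq_mul]
  exact mpKernel_offDiag_le hπ hQ hh hrev hxy

end CorollaryOne

end Literature.Probability.MarkovChains
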